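import Summits.Ventures.CertifiedManyBodySolver.Theorems.TcThermcert1FreeGasDefs
import Summits.Ventures.CertifiedManyBodySolver.Theorems.TcThermcert1FreeGasTwistedTrace
import Summits.Ventures.CertifiedManyBodySolver.Observables.StiffnessThermalLeaf
import HarnessLib

/-!
# Free-gas (`U = 0`) sector witness for TcThermcert1's K1 family — part 3: `Z_{(a,b)} = e_a(w) e_b(w)` and the sector
# log-partition function of the seam-flux torus (support target ST-K1-U0-1)

(f) of the model glue: `sectorTrace_free_eq_esymmW_mul` — for EVERY spin-resolved sector `(N↑, N↓) = (a, b)` the canonical partition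
function of the free twisted torus gas is `e_a(w) e_b(w)`, `w_k = exp(−β ξ_k(θ))` (double Fourier coefficient
`trace_sectorIndicator_mul_eq_integral` × `esymmW_fourierCoeff` shifted to `[0, 2π]`); hence **`stub_sectorLogZ_free`**: for `L ≥ 3`,
`thermalFluxLogZ L 0 0 (1 − 7/8) β θ = 2 log e_{⌊(7/8)L²/2⌋}(w_L(β,θ))` (the name is kept from the crux workfile, where it was the
sorried stub booked as ST-K1-U0-1), `thermalFluxLogZ_free_eq` (any filling `δ`), and the `Prop` form `SectorLogZFreeFactorisation`.
HONEST FRAMING: statements about the FREE (`U = 0`) twisted torus gas and about symmetric functions of explicit reals;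
nothing here touches `U = 8`; superconductivity in the Hubbard model is NOT proved (or disproved) by any of this.
Provenance: landed form of the crux workfile `Cruxes/ThermalStiffnessCeilingU8b10_le_1o8/FreeGasArcSkeleton.lean` v4.1 (tree 80a90c42bbb7)
+ `FreeGasArcInputs.lean` (d3c3c585d14e), planner `hubbard-floor-idea-rescuer` g5, card `free-gas-arc-darroch` (crit-1 KEEP);
hubbard-floor support target ST-K1-U0-1, `--supports stmt-Ventures-26381` (TcThermcert1 crux K1). Split into ≤ 400-line modules
`Theorems/TcThermcert1FreeGas*.lean`.
-/

noncomputable section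

namespace Summit.Ventures.CertifiedManyBodySolver.Theorems.FreeGasArc

open Filter Topology Set Real Finset
open Summit.Ventures.CertifiedManyBodySolver.Observables
open Literature.MathematicalPhysics.QuantumLattice
open Literature.Probability.LatticeModels (TorusSite latticeMomentum)
open scoped BigOperators

section StubOneProof

open Matrix
open Literature.MathematicalPhysics.QuantumFieldTheory
open scoped ComplexConjugate

variable {L : ℕ} [NeZero L]

/-! ### (f) Fourier extraction: the `(M, M)` sector trace is `e_M(w)²` -/

/-- **Coefficient extraction on `[0, 2π]` at fugacity `1`:** `∫₀^{2π} e^{−iMφ} ∏_k (1 + w_k e^{iφ}) dφ = 2π e_M(w)`. -/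
theorem integral_twistChar_prod {ι : Type} [Fintype ι] [DecidableEq ι] (w : ι → ℝ) (M : ℕ) :
    ∫ φ in (0:ℝ)..2 * π, Complex.exp (-((M : ℂ) * φ * Complex.I)) * ∏ k, ((1 : ℂ) + (w k : ℂ) * Complex.exp (φ * Complex.I))
      = 2 * π * ((esymmW w M : ℝ) : ℂ) := by
  have hper : Function.Periodic (fun φ : ℝ => Complex.exp (-((M : ℂ) * φ * Complex.I)) *
      ∏ k, ((1 : ℂ) + (w k : ℂ) * Complex.exp (φ * Complex.I))) (2 * π) := by
    intro φ
    have h1 : Complex.exp (((φ + 2 * π : ℝ) : ℂ) * Complex.I) = Complex.exp ((φ : ℂ) * Complex.I) := by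
      push_cast
      rw [add_mul, Complex.exp_add, Complex.exp_two_pi_mul_I, mul_one]
    have h2 : Complex.exp (-((M : ℂ) * ((φ + 2 * π : ℝ) : ℂ) * Complex.I)) = Complex.exp (-((M : ℂ) * φ * Complex.I)) := by
      rw [show -((M : ℂ) * ((φ + 2 * π : ℝ) : ℂ) * Complex.I) =
          -((M : ℂ) * φ * Complex.I) + ((-(M : ℤ) : ℤ) : ℂ) * (2 * π * Complex.I) by push_cast; ring,
        Complex.exp_add, Complex.exp_int_mul_two_pi_mul_I, mul_one]
    show Complex.exp (-((M : ℂ) * ((φ + 2 * π : ℝ) : ℂ) * Complex.I)) *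
        ∏ k, ((1 : ℂ) + (w k : ℂ) * Complex.exp (((φ + 2 * π : ℝ) : ℂ) * Complex.I)) = _
    rw [h1, h2]
  have hshift := hper.intervalIntegral_add_eq (-π) 0
  rw [zero_add, show -π + 2 * π = π by ring] at hshift
  rw [← hshift]
  have h3 := FreeGasArc.Inputs.esymmW_fourierCoeff w 1 M
  simp only [one_mul, one_pow, mul_one] at h3
  exact h3  -- `esymmW` here and `FreeGasArc.Inputs.esymmW` have the same body (`esymmW_eq_inputs` below is `rfl`)

/-- **(f) The `(a, b)` sector trace of the free twisted Gibbs weight is `e_a(w(β,θ)) · e_b(w(β,θ))`** (general spin-resolved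
particle numbers; the `(N↑, N↓) = (a, b)` canonical partition function of the free twisted torus gas). -/
theorem sectorTrace_free_eq_esymmW_mul (β θ : ℝ) (a b : ℕ) :
    ((diagonal fun s : Finset (Orb (FermionTorus 2 L)) =>
        if (upPart s).card = a ∧ (downPart s).card = b then (1 : ℂ) else 0) *
      gibbsWeight β (dGamma (twistedOneBody L ![θ, 0] 0))).trace =
      ((esymmW (freeWeight L β θ) a * esymmW (freeWeight L β θ) b : ℝ) : ℂ) := by
  rw [trace_sectorIndicator_mul_eq_integral_decEq]
  -- the twisted trace in closed form
  have htw : ∀ φ χ : ℝ,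
      ((diagonal fun s : Finset (Orb (FermionTorus 2 L)) =>
          Complex.exp (((((upPart s).card : ℝ) * φ + ((downPart s).card : ℝ) * χ : ℝ) : ℂ) * Complex.I)) *
        gibbsWeight β (dGamma (twistedOneBody L ![θ, 0] 0))).trace =
      (∏ k, ((1 : ℂ) + (freeWeight L β θ k : ℂ) * Complex.exp (φ * Complex.I))) *
        ∏ k, ((1 : ℂ) + (freeWeight L β θ k : ℂ) * Complex.exp (χ * Complex.I)) := by
    intro φ χ
    have hdiag : (diagonal fun s : Finset (Orb (FermionTorus 2 L)) =>
          Complex.exp (((((upPart s).card : ℝ) * φ + ((downPart s).card : ℝ) * χ : ℝ) : ℂ) * Complex.I)) =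
        NormedSpace.exp (∑ σ : Fin 2, (![(φ : ℂ) * Complex.I, (χ : ℂ) * Complex.I] σ) •
          ∑ x : FermionTorus 2 L, numberAt (orb x σ)) := by
      rw [exp_sum_smul_spinNumber_eq_diagonal_decEq]
      congr 1
      funext s
      congr 1
      simp only [Matrix.cons_val_zero, Matrix.cons_val_one]
      push_cast
      ring
    rw [hdiag, trace_exp_spinTwist_mul_gibbsWeight_dGamma_twistedOneBody, ← Finset.prod_mul_distrib]
    refine Finset.prod_congr rfl fun k _ => ?_
    simp only [Fin.prod_univ_two, Matrix.cons_val_zero, Matrix.cons_val_one, freeWeight, neg_mul]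
    ring
  simp_rw [htw]
  -- factorise the double integral
  have hsplit : ∀ φ χ : ℝ, Complex.exp (-((((a : ℝ) * φ + (b : ℝ) * χ : ℝ) : ℂ) * Complex.I)) *
      ((∏ k, ((1 : ℂ) + (freeWeight L β θ k : ℂ) * Complex.exp (φ * Complex.I))) *
        ∏ k, ((1 : ℂ) + (freeWeight L β θ k : ℂ) * Complex.exp (χ * Complex.I))) =
      (Complex.exp (-((a : ℂ) * φ * Complex.I)) * ∏ k, ((1 : ℂ) + (freeWeight L β θ k : ℂ) * Complex.exp (φ * Complex.I))) *
        (Complex.exp (-((b : ℂ) * χ * Complex.I)) *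
          ∏ k, ((1 : ℂ) + (freeWeight L β θ k : ℂ) * Complex.exp (χ * Complex.I))) := by
    intro φ χ
    rw [show -((((a : ℝ) * φ + (b : ℝ) * χ : ℝ) : ℂ) * Complex.I) =
        -((a : ℂ) * φ * Complex.I) + -((b : ℂ) * χ * Complex.I) by push_cast; ring, Complex.exp_add]
    ring
  simp_rw [hsplit, intervalIntegral.integral_const_mul, intervalIntegral.integral_mul_const, integral_twistChar_prod]
  have hπ : (π : ℂ) ≠ 0 := by exact_mod_cast Real.pi_ne_zero
  push_cast
  field_simp

/-- **(f) The `(M, M)` sector trace of the free twisted Gibbs weight is `e_M(w(β,θ))²`.** -/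
theorem sectorTrace_free_eq_esymmW_sq (β θ : ℝ) (M : ℕ) :
    ((diagonal fun s : Finset (Orb (FermionTorus 2 L)) =>
        if (upPart s).card = M ∧ (downPart s).card = M then (1 : ℂ) else 0) *
      gibbsWeight β (dGamma (twistedOneBody L ![θ, 0] 0))).trace = (((esymmW (freeWeight L β θ) M) ^ 2 : ℝ) : ℂ) := by
  rw [sectorTrace_free_eq_esymmW_mul, sq]

end StubOneProof

/-- **MODEL GLUE (stub 1) — PROVED (v4, §6 above).** For `L ≥ 3` and every `β, θ`: the `(N_L, S^z = 0)` sector log-partition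
function of `hubbardTorusTT'Flux L 0 0 θ` equals `2 log e_{M_L}(w_L(β,θ))` (`e_M` = elementary symmetric function of degree
`M_L = ⌊(7/8)L²/2⌋` of the `L²` twisted Boltzmann weights `w_k = exp(−β ξ_k(θ))`). The name is kept from v1–v3, where this was
the sorried stub; it is now a theorem, so every composition downstream is unconditional. -/
theorem stub_sectorLogZ_free (β θ : ℝ) (L : ℕ) [NeZero L] (hL : 3 ≤ L) :
    thermalFluxLogZ L 0 0 (1 - 7 / 8) β θ = 2 * Real.log (esymmW (freeWeight L β θ) (halfCount L)) := by
  rw [thermalFluxLogZ, halfCount, partitionFn_toBlock_flux_free_eq_trace hL β θ, sectorTrace_free_eq_esymmW_sq,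
    Complex.ofReal_re, Real.log_pow, Nat.cast_ofNat]

/-- The same glue at an arbitrary filling parameter `δ` (sector `N↑ = N↓ = ⌊(1 − δ)L²/2⌋`): for `L ≥ 3`,
`thermalFluxLogZ L 0 0 δ β θ = 2 log e_{⌊(1−δ)L²/2⌋}(w_L(β, θ))` — re-usable by the crux's other `U = 0` calibrations. -/
theorem thermalFluxLogZ_free_eq (δ β θ : ℝ) (L : ℕ) [NeZero L] (hL : 3 ≤ L) :
    thermalFluxLogZ L 0 0 δ β θ = 2 * Real.log (esymmW (freeWeight L β θ) ⌊(1 - δ) * (L : ℝ) ^ 2 / 2⌋₊) := by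
  rw [thermalFluxLogZ, partitionFn_toBlock_flux_free_eq_trace hL β θ, sectorTrace_free_eq_esymmW_sq,
    Complex.ofReal_re, Real.log_pow, Nat.cast_ofNat]

end Summit.Ventures.CertifiedManyBodySolver.Theorems.FreeGasArc

end
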